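import Summits.SmoothPoincare4.SmoothPoincare4.Theorems.CongruenceShadowsShadowApproximationStubLayerStepTwoZeroNormal
import Summits.SmoothPoincare4.SmoothPoincare4.Theorems.CongruenceShadowsShadowApproximationStubLayerStepTwoZeroRealisers
import HarnessLib

/-!
# Helper for stub `stub_layerStepTwoZero` (line `nilpotent-genus-class`, crux
`CongruenceShadows.ShadowApproximation`, item stmt-SmoothPoincare4-14595):
# the layer step `(m,c) = (2,0)` from a permutation certificate

`S = SurfaceGroup 9` (`9 = 3 + 3·2`), `N i = s4Kernels.stabilizeIter 2 i`, `γₖ₊₁ = (⊤).lowerCentralSeries k`.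
`layerStep9_of_certificate`: GIVEN base integer matrices `Mb t` (inverses `Mbi t`, signs `εb t`, handles `kb t`)
passing the decidable Goeritz checks, and for every triple of handles `(a,b,c)` a base type `typ a b c`, a
residue-preserving handle permutation `τt a b c` (inverse `σt a b c`) and a sign `sg a b c = ±1` such that for every
ALLOWED increasing triple (`a < b < c`, not `(1,4,7)`, not `(2,5,8)`) the collapsed closed-form reading of the permuted
conjugated seed realiser (`exists_perm_conj_realiser₉`) is EXACTLY `sg a b c · e_{abc}` (the elementary alternating form)
— all decidable on concrete data —, THEN the layer step at `(2,0)` holds: for a kernel triple `K` of genus `9` with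
`K 0 = N 0`, `K 1 = N 1`, Waldhausen pairs and `K 2 γ₂ = N 2 γ₂`, some `y ∈ Stab N₀ ∩ Stab N₁` has `y(N₂ γ₃) = K₂ γ₃`,
granted (AUTSYMP) at genus `9`.
Proof (the genus-`9` analogue of the landed genus-`6` `layerStep_of_certificate`, plus the degree-`1` gate): slot-keeping
pair normalisations `α' ∈ IA ∩ Stab N₀`, `β' ∈ IA ∩ Stab N₁` with `α'(N₂) = β'(N₂) = K₂`
(`exists_ia_stab_of_pair_stabilizeIter`, pairs `(0,2)` and `(1,2)`); the reading `D` of `α'` is alternating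
(`reading_ia_g`) with `D(1,4,7) = 0` (`reading_eq_zero_of_map_stabilizeIter_eq` for `α'`) and `D(2,5,8) = 0` (the same
for `β'`, transferred by `forms_eq_of_map_eq`); so `D = ∑_{allowed a<b<c} D_{abc} e_{abc}` on `v < w`
(`alt_eq_sum_elementary`), and `y = ∏_{a<b<c} y_{abc} ^ (sg a b c · D_{abc})` reads as `D` (`reading_list_prod_zpow` + the
certificate), whence `y(N₂)γ₃ = α'(N₂)γ₃ = K₂γ₃` (`map_sup_eq_of_forms_g`).  No definitions; the data live in the stub file.
-/

set_option linter.dupNamespace false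

noncomputable section

open Subgroup Literature.Topology.FourManifolds Literature.Algebra.Lie Multiplicative
open Summit.SmoothPoincare4.SmoothPoincare4.Theorems.NilpotentShadowsStandard.SaturatedTorsorDescent
open scoped commutatorElement

namespace Summit.SmoothPoincare4.SmoothPoincare4.Theorems.ShadowApproximation.NilpotentGenusClass

/-! ## The layer step `(2,0)` from a permutation certificate -/

section Certificate

/-- Membership of a coordinate cut letter in the coordinate cut system. [folklore] -/
theorem mem_s4CutSystem_of_decide {m : ℕ} (i : Fin 3) (h : Fin (3 + 3 * m)) :
    (h, decide ((((h : Fin (3 + 3 * m)) : ℕ) + (i : ℕ)) % 3 = 2)) ∈ s4CutSystem m i := by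
  rw [s4CutSystem_eq_range]; exact ⟨h, rfl⟩

/-- **The layer step `(2,0)` from a permutation certificate** (see the module docstring). [folklore] -/
theorem layerStep9_of_certificate {κ : Type}
    (Mb Mbi : κ → Matrix (Fin (3 + 3 * 2) × Bool) (Fin (3 + 3 * 2) × Bool) ℤ) (εb : κ → ℤ) (kb : κ → Fin (3 + 3 * 2))
    (typ : Fin (3 + 3 * 2) → Fin (3 + 3 * 2) → Fin (3 + 3 * 2) → κ) (τt σt : Fin (3 + 3 * 2) → Fin (3 + 3 * 2) → Fin (3 + 3 * 2) → Fin (3 + 3 * 2) → Fin (3 + 3 * 2))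
    (sg : Fin (3 + 3 * 2) → Fin (3 + 3 * 2) → Fin (3 + 3 * 2) → ℤ)
    (hε : ∀ t, εb t = 1 ∨ εb t = -1) (hinv : ∀ t, Mb t * Mbi t = 1) (hinv' : ∀ t, Mbi t * Mb t = 1)
    (hS : ∀ t (x y : Fin (3 + 3 * 2) × Bool), symplForm (fun q => Mb t q x) (fun q => Mb t q y) =
      εb t * symplForm (Pi.single x (1 : ℤ) : Fin (3 + 3 * 2) × Bool → ℤ) (Pi.single y (1 : ℤ)))
    (h0 : ∀ t (a b : Fin (3 + 3 * 2)), Mb t (a, !decide ((a : ℕ) % 3 = 2)) (b, decide ((b : ℕ) % 3 = 2)) = 0)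
    (h1 : ∀ t (a b : Fin (3 + 3 * 2)), Mb t (a, !decide ((a : ℕ) % 3 = 1)) (b, decide ((b : ℕ) % 3 = 1)) = 0)
    (hστ : ∀ a b c h, σt a b c (τt a b c h) = h) (hτσ : ∀ a b c h, τt a b c (σt a b c h) = h)
    (hres : ∀ a b c h : Fin (3 + 3 * 2), ((τt a b c h : Fin (3 + 3 * 2)) : ℕ) % 3 = ((h : Fin (3 + 3 * 2)) : ℕ) % 3)
    (hsg : ∀ a b c, sg a b c = 1 ∨ sg a b c = -1)
    (hR : ∀ (a b c : Fin (3 + 3 * 2)), a < b → b < c → ¬(a = 1 ∧ b = 4 ∧ c = 7) → ¬(a = 2 ∧ b = 5 ∧ c = 8) →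
      ∀ (j v w : Fin (3 + 3 * 2)), v < w → ((if decide (((j : Fin (3 + 3 * 2)) : ℕ) % 3 = 0) then (-1 : ℤ) else 1) * (((Mbi (typ a b c)) ((kb (typ a b c) : Fin (3 + 3 * 2)), false) ((τt a b c) j, decide (((j : Fin (3 + 3 * 2)) : ℕ) % 3 = 0)) * ((Mb (typ a b c)) ((τt a b c) v, !decide (((v : Fin (3 + 3 * 2)) : ℕ) % 3 = 0)) ((kb (typ a b c) : Fin (3 + 3 * 2)), false) * (Mb (typ a b c)) ((τt a b c) w, !decide (((w : Fin (3 + 3 * 2)) : ℕ) % 3 = 0)) ((kb (typ a b c) : Fin (3 + 3 * 2)) + 1, true)) + -(Mbi (typ a b c)) ((kb (typ a b c) : Fin (3 + 3 * 2)), true) ((τt a b c) j, decide (((j : Fin (3 + 3 * 2)) : ℕ) % 3 = 0)) * ((Mb (typ a b c)) ((τt a b c) v, !decide (((v : Fin (3 + 3 * 2)) : ℕ) % 3 = 0)) ((kb (typ a b c) : Fin (3 + 3 * 2)) + 1, true) * (Mb (typ a b c)) ((τt a b c) w, !decide (((w : Fin (3 + 3 * 2)) : ℕ) % 3 = 0))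 ((kb (typ a b c) : Fin (3 + 3 * 2)), true)) + (Mbi (typ a b c)) ((kb (typ a b c) : Fin (3 + 3 * 2)) + 1, false) ((τt a b c) j, decide (((j : Fin (3 + 3 * 2)) : ℕ) % 3 = 0)) * ((Mb (typ a b c)) ((τt a b c) v, !decide (((v : Fin (3 + 3 * 2)) : ℕ) % 3 = 0)) ((kb (typ a b c) : Fin (3 + 3 * 2)), true) * (Mb (typ a b c)) ((τt a b c) w, !decide (((w : Fin (3 + 3 * 2)) : ℕ) % 3 = 0)) ((kb (typ a b c) : Fin (3 + 3 * 2)), false))) - ((Mbi (typ a b c)) ((kb (typ a b c) : Fin (3 + 3 * 2)), false) ((τt a b c) j, decide (((j : Fin (3 + 3 * 2)) : ℕ) % 3 = 0)) * ((Mb (typ a b c)) ((τt a b c) w, !decide (((w : Fin (3 + 3 * 2)) : ℕ) % 3 = 0)) ((kb (typ a b c) : Fin (3 + 3 * 2)), false) * (Mb (typ a b c)) ((τt a b c) v, !decide (((v : Fin (3 + 3 * 2)) : ℕ) % 3 = 0)) ((kb (typ a b c) : Fin (3 + 3 * 2)) + 1, true)) + -(Mbi (typ a b c)) ((kb (typ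 a b c) : Fin (3 + 3 * 2)), true) ((τt a b c) j, decide (((j : Fin (3 + 3 * 2)) : ℕ) % 3 = 0)) * ((Mb (typ a b c)) ((τt a b c) w, !decide (((w : Fin (3 + 3 * 2)) : ℕ) % 3 = 0)) ((kb (typ a b c) : Fin (3 + 3 * 2)) + 1, true) * (Mb (typ a b c)) ((τt a b c) v, !decide (((v : Fin (3 + 3 * 2)) : ℕ) % 3 = 0)) ((kb (typ a b c) : Fin (3 + 3 * 2)), true)) + (Mbi (typ a b c)) ((kb (typ a b c) : Fin (3 + 3 * 2)) + 1, false) ((τt a b c) j, decide (((j : Fin (3 + 3 * 2)) : ℕ) % 3 = 0)) * ((Mb (typ a b c)) ((τt a b c) w, !decide (((w : Fin (3 + 3 * 2)) : ℕ) % 3 = 0)) ((kb (typ a b c) : Fin (3 + 3 * 2)), true) * (Mb (typ a b c)) ((τt a b c) v, !decide (((v : Fin (3 + 3 * 2)) : ℕ) % 3 = 0)) ((kb (typ a b c) : Fin (3 + 3 * 2)), false))))) = sg a b c * (if j = a ∧ v = b ∧ w = c then (1 : ℤ) else if j = c ∧ v = a ∧ w = b then (1 : ℤ) else if j = b ∧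 v = a ∧ w = c then (-1 : ℤ) else 0))
    (hA : (∀ (φ : (SurfaceGroup (3 + 3 * 2)) ≃* (SurfaceGroup (3 + 3 * 2))), ∃ (F : (surfaceGen (3 + 3 * 2) → ℤ) ≃ₗ[ℤ] (surfaceGen (3 + 3 * 2) → ℤ)) (ε : ℤ),
      (ε = 1 ∨ ε = -1) ∧ (∀ s : (SurfaceGroup (3 + 3 * 2)), toAdd (SurfaceGroup.abelianize (3 + 3 * 2) (φ s)) =
        F (toAdd (SurfaceGroup.abelianize (3 + 3 * 2) s))) ∧
        ∀ u v : surfaceGen (3 + 3 * 2) → ℤ, symplForm (F u) (F v) = ε * symplForm u v))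
    (K : TrisectionKernels (3 + 3 * 2)) (hK0 : K 0 = s4Kernels.stabilizeIter 2 0) (hK1 : K 1 = s4Kernels.stabilizeIter 2 1)
    (hW : ∀ i j : Fin 3, i ≠ j → ∃ α : (SurfaceGroup (3 + 3 * 2)) ≃* (SurfaceGroup (3 + 3 * 2)),
      (s4Kernels.stabilizeIter 2 i).map α.toMonoidHom = K i ∧ (s4Kernels.stabilizeIter 2 j).map α.toMonoidHom = K j)
    (hK2 : K 2 ⊔ ((⊤ : Subgroup (SurfaceGroup (3 + 3 * 2))).lowerCentralSeries 1) = s4Kernels.stabilizeIter 2 2 ⊔ ((⊤ : Subgroup (SurfaceGroup (3 + 3 * 2))).lowerCentralSeries 1)) :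
    ∃ y : (SurfaceGroup (3 + 3 * 2)) ≃* (SurfaceGroup (3 + 3 * 2)),
      (s4Kernels.stabilizeIter 2 0).map y.toMonoidHom = s4Kernels.stabilizeIter 2 0 ∧
      (s4Kernels.stabilizeIter 2 1).map y.toMonoidHom = s4Kernels.stabilizeIter 2 1 ∧
      (s4Kernels.stabilizeIter 2 2 ⊔ ((⊤ : Subgroup (SurfaceGroup (3 + 3 * 2))).lowerCentralSeries 2)).map y.toMonoidHom = K 2 ⊔ ((⊤ : Subgroup (SurfaceGroup (3 + 3 * 2))).lowerCentralSeries 2) := by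
  classical
  -- (1) slot-keeping pair normalisations from the pairs `(0,2)` and `(1,2)`
  obtain ⟨α, hα0, hα2⟩ := hW 0 2 (by decide)
  rw [hK0] at hα0
  obtain ⟨α', hα'IA, hα'0, hα'2⟩ := exists_ia_stab_of_pair_stabilizeIter (m := 2) hA (i := 0) (by decide) hα0 hα2 hK2
  obtain ⟨β, hβ1, hβ2⟩ := hW 1 2 (by decide)
  rw [hK1] at hβ1
  obtain ⟨β', hβ'IA, hβ'1, hβ'2⟩ := exists_ia_stab_of_pair_stabilizeIter (m := 2) hA (i := 1) (by decide) hβ1 hβ2 hK2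
  -- (2) the cut dictionary of slot `2` (cut letters `bⱼ` on `j ≡ 0`, `aⱼ` elsewhere)
  obtain ⟨ct, π, hct, hπs, hπker, hπof⟩ := helper_glueErasePi 2 2 (stub_cutNormalForm 2 2)
  have hctf : ct = fun h : Fin (3 + 3 * 2) => decide ((h : ℕ) % 3 = 0) := by
    funext h
    have hm : (h, decide ((((h : ℕ)) + ((2 : Fin 3) : ℕ)) % 3 = 2)) ∈ s4CutSystem 2 2 := by
      rw [s4CutSystem_eq_range]; exact ⟨h, rfl⟩
    rw [← (hct h _).1 hm]
    simp only [Fin.val_two]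
    by_cases hh : (h : ℕ) % 3 = 0
    · rw [decide_eq_true hh, decide_eq_true (by omega)]
    · rw [decide_eq_false hh, decide_eq_false (by omega)]
  subst hctf
  -- (3) the readings of `α'`, `β'`; the two vanishing coordinates of the honest datum
  obtain ⟨Dα, hDα1, hDα2, hDα⟩ := reading_ia_g hπs hπker hπof α' hα'IA
  obtain ⟨Dβ, -, -, hDβ⟩ := reading_ia_g hπs hπker hπof β' hβ'IA
  have hmem : ∀ (i : Fin 3) (h : Fin (3 + 3 * 2)), (((h : ℕ) + (i : ℕ)) % 3 = 2 ↔ (h : ℕ) % 3 = 0) →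
      (h, decide ((h : ℕ) % 3 = 0)) ∈ s4CutSystem 2 i := by
    intro i h hiff
    have e : decide ((h : ℕ) % 3 = 0) = decide ((((h : Fin (3 + 3 * 2)) : ℕ) + (i : ℕ)) % 3 = 2) := by
      by_cases hh : (h : ℕ) % 3 = 0
      · rw [decide_eq_true hh, decide_eq_true (hiff.2 hh)]
      · rw [decide_eq_false hh, decide_eq_false (fun h' => hh (hiff.1 h'))]
    rw [e]; exact mem_s4CutSystem_of_decide i h
  have h147 : Dα 1 4 7 = 0 :=
    reading_eq_zero_of_map_stabilizeIter_eq hπs hπof 0 α' hα'IA hα'0 Dα hDα 1 4 7 (by decide)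
      (hmem 0 1 (by decide)) (hmem 0 4 (by decide)) (hmem 0 7 (by decide))
  have h258 : Dα 2 5 8 = 0 := by
    rw [forms_eq_of_map_eq hπs hπker hπof α' β' hα'IA hβ'IA Dα Dβ hDα hDβ (hα'2.trans hβ'2.symm) 2 5 8 (by decide)]
    exact reading_eq_zero_of_map_stabilizeIter_eq hπs hπof 1 β' hβ'IA hβ'1 Dβ hDβ 2 5 8 (by decide)
      (hmem 1 2 (by decide)) (hmem 1 5 (by decide)) (hmem 1 8 (by decide))
  -- (4) the realisers and their readings, for every triple of handles
  have hreal := fun (a b c : Fin (3 + 3 * 2)) => exists_perm_conj_realiser₉ (kb (typ a b c)) (Mb (typ a b c)) (Mbi (typ a b c))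
    (εb (typ a b c)) (hε _) (hinv _) (hinv' _) (hS _) (h0 _) (h1 _) (τt a b c) (σt a b c) (hστ a b c) (hτσ a b c)
    (hres a b c) hπs hπof
  choose Y hY0 hY1 hYIA hYD using hreal
  -- (5) the exponents and the product realiser over `ι = Fin 9 × Fin 9 × Fin 9`
  set nexp : Fin (3 + 3 * 2) × Fin (3 + 3 * 2) × Fin (3 + 3 * 2) → ℤ := fun i =>
    if i.1 < i.2.1 ∧ i.2.1 < i.2.2 then sg i.1 i.2.1 i.2.2 * Dα i.1 i.2.1 i.2.2 else 0 with hnexp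
  obtain ⟨hyIA, hyD⟩ := reading_list_prod_zpow (Finset.univ.toList) (fun i : Fin (3 + 3 * 2) × Fin (3 + 3 * 2) × Fin (3 + 3 * 2) => Y i.1 i.2.1 i.2.2)
    nexp (fun i => hYIA _ _ _) _ (fun i => hYD _ _ _)
  refine ⟨((Finset.univ.toList).map fun i : Fin (3 + 3 * 2) × Fin (3 + 3 * 2) × Fin (3 + 3 * 2) =>
      ((Y i.1 i.2.1 i.2.2 : MulAut (SurfaceGroup (3 + 3 * 2))) ^ nexp i : MulAut (SurfaceGroup (3 + 3 * 2)))).prod,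
    map_list_prod_eq_of_forall _ _ _ fun i => map_zpow_eq_of_map_eq (Y i.1 i.2.1 i.2.2) (hY0 _ _ _) _,
    map_list_prod_eq_of_forall _ _ _ fun i => map_zpow_eq_of_map_eq (Y i.1 i.2.1 i.2.2) (hY1 _ _ _) _, ?_⟩
  -- (6) equal readings: the certificate
  have heq : ∀ j v w : Fin (3 + 3 * 2), v < w →
      ((Finset.univ.toList).map fun i : Fin (3 + 3 * 2) × Fin (3 + 3 * 2) × Fin (3 + 3 * 2) => nexp i * ((if decide (((j : Fin (3 + 3 * 2)) : ℕ) % 3 = 0) then (-1 : ℤ) else 1) * (((Mbi (typ i.1 i.2.1 i.2.2)) ((kb (typ i.1 i.2.1 i.2.2) : Fin (3 + 3 * 2)), false) ((τt i.1 i.2.1 i.2.2) j, decide (((j : Fin (3 + 3 * 2)) : ℕ) % 3 = 0)) * ((Mb (typ i.1 i.2.1 i.2.2)) ((τt i.1 i.2.1 i.2.2) v, !decide (((v : Fin (3 + 3 * 2)) : ℕ) % 3 = 0)) ((kb (typ i.1 i.2.1 i.2.2) : Fin (3 + 3 * 2)), false) * (Mb (typ i.1 i.2.1 i.2.2)) ((τt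 i.1 i.2.1 i.2.2) w, !decide (((w : Fin (3 + 3 * 2)) : ℕ) % 3 = 0)) ((kb (typ i.1 i.2.1 i.2.2) : Fin (3 + 3 * 2)) + 1, true)) + -(Mbi (typ i.1 i.2.1 i.2.2)) ((kb (typ i.1 i.2.1 i.2.2) : Fin (3 + 3 * 2)), true) ((τt i.1 i.2.1 i.2.2) j, decide (((j : Fin (3 + 3 * 2)) : ℕ) % 3 = 0)) * ((Mb (typ i.1 i.2.1 i.2.2)) ((τt i.1 i.2.1 i.2.2) v, !decide (((v : Fin (3 + 3 * 2)) : ℕ) % 3 = 0)) ((kb (typ i.1 i.2.1 i.2.2) : Fin (3 + 3 * 2)) + 1, true) * (Mb (typ i.1 i.2.1 i.2.2)) ((τt i.1 i.2.1 i.2.2) w, !decide (((w : Fin (3 + 3 * 2)) : ℕ) % 3 = 0)) ((kb (typ i.1 i.2.1 i.2.2) : Fin (3 + 3 * 2)), true)) + (Mbi (typ i.1 i.2.1 i.2.2)) ((kb (typ i.1 i.2.1 i.2.2) : Fin (3 + 3 * 2)) + 1, false) ((τt i.1 i.2.1 i.2.2) j, decide (((j : Fin (3 + 3 * 2)) : ℕ)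 % 3 = 0)) * ((Mb (typ i.1 i.2.1 i.2.2)) ((τt i.1 i.2.1 i.2.2) v, !decide (((v : Fin (3 + 3 * 2)) : ℕ) % 3 = 0)) ((kb (typ i.1 i.2.1 i.2.2) : Fin (3 + 3 * 2)), true) * (Mb (typ i.1 i.2.1 i.2.2)) ((τt i.1 i.2.1 i.2.2) w, !decide (((w : Fin (3 + 3 * 2)) : ℕ) % 3 = 0)) ((kb (typ i.1 i.2.1 i.2.2) : Fin (3 + 3 * 2)), false))) - ((Mbi (typ i.1 i.2.1 i.2.2)) ((kb (typ i.1 i.2.1 i.2.2) : Fin (3 + 3 * 2)), false) ((τt i.1 i.2.1 i.2.2) j, decide (((j : Fin (3 + 3 * 2)) : ℕ) % 3 = 0)) * ((Mb (typ i.1 i.2.1 i.2.2)) ((τt i.1 i.2.1 i.2.2) w, !decide (((w : Fin (3 + 3 * 2)) : ℕ) % 3 = 0)) ((kb (typ i.1 i.2.1 i.2.2) : Fin (3 + 3 * 2)), false) * (Mb (typ i.1 i.2.1 i.2.2)) ((τt i.1 i.2.1 i.2.2) v, !decide (((v : Fin (3 + 3 * 2)) : ℕ) % 3 = 0)) ((kb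 (typ i.1 i.2.1 i.2.2) : Fin (3 + 3 * 2)) + 1, true)) + -(Mbi (typ i.1 i.2.1 i.2.2)) ((kb (typ i.1 i.2.1 i.2.2) : Fin (3 + 3 * 2)), true) ((τt i.1 i.2.1 i.2.2) j, decide (((j : Fin (3 + 3 * 2)) : ℕ) % 3 = 0)) * ((Mb (typ i.1 i.2.1 i.2.2)) ((τt i.1 i.2.1 i.2.2) w, !decide (((w : Fin (3 + 3 * 2)) : ℕ) % 3 = 0)) ((kb (typ i.1 i.2.1 i.2.2) : Fin (3 + 3 * 2)) + 1, true) * (Mb (typ i.1 i.2.1 i.2.2)) ((τt i.1 i.2.1 i.2.2) v, !decide (((v : Fin (3 + 3 * 2)) : ℕ) % 3 = 0)) ((kb (typ i.1 i.2.1 i.2.2) : Fin (3 + 3 * 2)), true)) + (Mbi (typ i.1 i.2.1 i.2.2)) ((kb (typ i.1 i.2.1 i.2.2) : Fin (3 + 3 * 2)) + 1, false) ((τt i.1 i.2.1 i.2.2) j, decide (((j : Fin (3 + 3 * 2)) : ℕ) % 3 = 0)) * ((Mb (typ i.1 i.2.1 i.2.2)) ((τt i.1 i.2.1 i.2.2)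 w, !decide (((w : Fin (3 + 3 * 2)) : ℕ) % 3 = 0)) ((kb (typ i.1 i.2.1 i.2.2) : Fin (3 + 3 * 2)), true) * (Mb (typ i.1 i.2.1 i.2.2)) ((τt i.1 i.2.1 i.2.2) v, !decide (((v : Fin (3 + 3 * 2)) : ℕ) % 3 = 0)) ((kb (typ i.1 i.2.1 i.2.2) : Fin (3 + 3 * 2)), false)))))).sum = Dα j v w := by
    intro j v w hvw
    rw [Finset.sum_map_toList, alt_eq_sum_elementary Dα hDα1 hDα2 j v w hvw, Fintype.sum_prod_type]
    refine Finset.sum_congr rfl fun a _ => ?_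
    rw [Fintype.sum_prod_type]
    refine Finset.sum_congr rfl fun b _ => Finset.sum_congr rfl fun c _ => ?_
    simp only [hnexp]
    by_cases habc : a < b ∧ b < c
    · rw [if_pos habc, if_pos habc]
      by_cases hx1 : (a = 1 ∧ b = 4 ∧ c = 7)
      · obtain ⟨rfl, rfl, rfl⟩ := hx1
        rw [h147, mul_zero, zero_mul, zero_mul]
      by_cases hx2 : (a = 2 ∧ b = 5 ∧ c = 8)
      · obtain ⟨rfl, rfl, rfl⟩ := hx2
        rw [h258, mul_zero, zero_mul, zero_mul]
      rw [hR a b c habc.1 habc.2 hx1 hx2 j v w hvw]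
      rcases hsg a b c with hs | hs <;> rw [hs] <;> ring
    · rw [if_neg habc, if_neg habc, zero_mul]
  rw [map_sup_eq_of_forms_g hct hπs hπker hπof _ α' hyIA hα'IA _ Dα hyD hDα heq, hα'2]

end Certificate

/-! ## Registered helper -/

/-- **Registered helper `helper_memCutSystemDecide`** (sub-goal of stub `stub_layerStepTwoZero`, crux stmt-SmoothPoincare4-14595;
the file's main theorem `layerStep9_of_certificate` exceeds the registry's signature size): the coordinate cut letter
`(h, (h + i ≡ 2 mod 3))` lies in the coordinate cut system `s4CutSystem m i`. [folklore] -/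
theorem helper_memCutSystemDecide : ∀ (m : ℕ) (i : Fin 3) (h : Fin (3 + 3 * m)), (h, decide ((((h : Fin (3 + 3 * m)) : ℕ) + (i : ℕ)) % 3 = 2)) ∈ s4CutSystem m i :=
  fun _ i h => mem_s4CutSystem_of_decide i h

end Summit.SmoothPoincare4.SmoothPoincare4.Theorems.ShadowApproximation.NilpotentGenusClass

end
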